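/-
Origin: expansion seat `planner-pub-hodgecm-mc-glue-1-g11-0`, handover #398J2HHTCGU 2026-08-20T17:24:48Z md5 4557b454c8a4 (NEW; 76 l.; KERNEL ONLY: 1 theorem, 0 defs, 0 records ∕ cites ∕ Prop-defs; NAME LIST: HodgeCM.Model.perL_picardCM_r21AEOGISTR2DJWHHTCGU; ROWDEPS none in-run, imports landed #SG31 + #1230; drop-alone) (`HOME/mc/pub-hodgecm-mc-glue-1-g11/stage57/HodgeCM/Model/E2InstanceOGR21AEPISTR2DJWHHTCGU.lean`, md5 4557b454c8a4, 76 lines);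
landed by the gen-23 packager (p-g23) in gate run 57 as `HodgeCM/Model/E2InstanceOGR21AEPISTR2DJWHHTCGU.lean` (verbatim).
-/
/-
Origin: CONSTRUCTION seat `planner-pub-hodgecm-mc-glue-1-g11-0` (unit pub-hodgecm-mc-glue-1-g11, gen 11 of mc-glue-1, node E ASSEMBLER), 2026-08-20,
generated from glue-1's #398J2HHTCG `E2InstanceOGR21AEPISTR2DJWHHTCG.lean` (RUN-56 scope-guarded body 8cd1441d0a40 = PKG fb70ff3b90a0 under the RUN-56 packager header, #SG31 of the (μ4) block; 4-ary universe text, context rows guarded by `Module.finrank ℚ c.K = 6 ∧ IsNormalClosure ℚ c.K L ∧ (Module.finrank ℚ L = 24 ∨ Module.finrank ℚ L = 48)`) by `tools/gen_child.py spec/str2djwhhtcgu57.json`.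
ROWDEPS: imports the guarded #398J2HHTCG = #SG31 of RUN 56 + sinst-1-g7's (GR-U) `Model/ThetaAdelicSideR2U` (RUN-55 #1230, PKG 9a2af468c745); drops with either.
Target in PKG: HodgeCM/Model/E2InstanceOGR21AEPISTR2DJWHHTCGU.lean (NEW additive KERNEL leaf beside E; E `Model/E2InstanceOGR21AEPI.lean` 4c667377ea4b (RUN 56) untouched).
KERNEL ONLY: 1 theorem; 0 records, nothing cited, 0 `def … : Prop`, no Literature path, MODEL-N ±0. Nothing here is a claim of the manuscripts under adjudication.
-/
import Summits.HodgeConjecture.HodgeCM.Model.E2InstanceOGR21AEPISTR2DJWHHTCG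
import Summits.HodgeConjecture.HodgeCM.Model.ThetaAdelicSideR2U

noncomputable section

open scoped TensorProduct InnerProductSpace Matrix

open Literature.NumberTheory.Automorphic Literature.NumberTheory.Weil1964
open Literature.NumberTheory.GelbartRogawski1991.UnitaryDualPair
open HodgeCM.Adelic HodgeCM.PerL34
open scoped Classical
open Literature.Geometry.ComplexHyperbolic.BallModel (U21 x₀ stabilizerEquivK21)
open Literature.NumberTheory.Automorphic.U21 (K21 matA sclD)

/-!
# E2InstanceOGR21AEPISTR2DJWHHTCGU — THE FIVE [GR91 3.1.1] GROUPS OF THE R2 LEAF AS ONE: `hGR hGR₀ hGR₁ hGR₂ hGR₃ := SInstance.GRU.hGR∗ hGRU`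

`perL_picardCM_r21AEOGISTR2DJWHHTCGU` = glue-1's #398J2HHTCG `perL_picardCM_r21AEOGISTR2DJWHHTCG` (9 groups `hA hGR hGR₀ hGR₁ hGR₂ hGR₃ μ hR hΘ`)
at the five DERIVED families `@SInstance.GRU.hGR∗ hGRU` of sinst-1-g7's `Model/ThetaAdelicSideR2U.lean`, where the ONE hypothesis `hGRU` is
[GR91 Prop. 3.1.1] (`SplittingDatum.CompatibleSplitting`) at EVERY constructed CM dual-pair datum `cmSplittingDatum L e dV … dW …`, spelled out as a
closed Π-type with no data of the model in it (the abbrev `SInstance.GRU` is avoided in the binder on sinst-1-g7's measured advice: syntactic matching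
at the 82 substitution sites, default heartbeats).  Every other group and the conclusion are #398J2HHTCG's with `@hGR∗` ∕ `hGR` rewritten to `(@SInstance.GRU.hGR∗ hGRU)`.

Result: **5 binder groups `hA hGRU μ hR hΘ`** = CITE 3 (one group per published theorem: `hA` [Arapura 2012 Cor. 15.4.6], `hGRU` [GR91 Prop. 3.1.1],
`hR` [DM82 Thm 6.20]) + DATA 1 (`μ`, row 6) + PROVE 1 (`hΘ`, row 9).  Conclusion unchanged:
`(picardCMUniverse hHD hI h₁ (cmAbelianVarietyRealised_of_eigenbasis hHD hI h₃)).PerL` (4-ary universe text after the (iib-R) re-base of RUN 55).  One application, no tactic search.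
-/

namespace HodgeCM

namespace Model

open HodgeCM.Model.ArchSideTerm
open HodgeCM.Universe (AdelicThetaCore AdelicThetaCore₀ SideData ThetaModel ModelAxiomsPerL)
open Literature.AlgebraicGeometry.HodgeTheory
open Literature.AlgebraicGeometry.ComplexMultiplication (Shimura1998_Thm3_isogenousPower Shimura1998_Thm2_Cor)
open Literature.NumberTheory.Automorphic.PicardCM
open Literature.NumberTheory.Transcendental (Arapura2012_Cor_15_4_6)
open HodgeCM.CMTypeOps (inflate)
open HodgeCM.Model.SupplyResidual (ClassSupplyPackN)
open HodgeCM.Model.ThetaSpace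

variable (hHD : exists_isReal_hodgeModel) (hI : hodgePQ_independent_of_hodgeModel)
  (h₁ : BallQuotientUniformised)  (h₃ : CMAbelianVarietyEigenbasisRealised)

/-- **ONE [GR91 3.1.1] GROUP** (`hGR∗ := @SInstance.GRU.hGR∗ hGRU`): 5 binder groups `hA hGRU μ hR hΘ`;
one application of `perL_picardCM_r21AEOGISTR2DJWHHTCG`. -/
theorem perL_picardCM_r21AEOGISTR2DJWHHTCGU (hA : Arapura2012_Cor_15_4_6)
    (hGRU : ∀ (L : Type) [Field L] [NumberField L] [NumberField.IsCMField L] {N M n : ℕ} (e : Fin N × Fin M ≃ Fin n)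
      (dV : Fin N → L) (hdV : ∀ i, NumberField.IsCMField.complexConj L (dV i) = dV i) (hdV0 : ∀ i, dV i ≠ 0)
      (dW : Fin M → L) (hdW : ∀ i, NumberField.IsCMField.complexConj L (dW i) = dW i) (hdW0 : ∀ i, dW i ≠ 0),
      (cmSplittingDatum L e dV hdV hdV0 dW hdW hdW0).CompatibleSplitting)
    (μ : ∀ {L : CMField}, SeesawCtx L → Fin 4 → NumberField.InfinitePlace L → ℤ)
    (hR : DeligneMilne1982_Thm_6_20_full)
    (hΘ : ∀ {L : CMField} {ι₁ : L →+* ℂ} (V : HermSpace3 L ι₁) (c : SeesawCtx L),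
      (thetaModelOf hHD hI h₁ (cmAbelianVarietyRealised_of_eigenbasis hHD hI h₃) (orientBitι L ι₁) (embOf hHD hI h₁ (cmAbelianVarietyRealised_of_eigenbasis hHD hI h₃)) (coverOf hHD hI h₁ (cmAbelianVarietyRealised_of_eigenbasis hHD hI h₃) hA) (wmOfInput (HypCensus.Wcm (@SInstance.GRU.hGR hGRU) (EtaChi.η (@SInstance.χVR (@SInstance.GRU.hGR hGRU) (@SInstance.GRU.hGR₀ hGRU) (@SInstance.GRU.hGR₁ hGRU)) (@SInstance.χWR (@SInstance.GRU.hGR hGRU) (@SInstance.GRU.hGR₀ hGRU) (@SInstance.GRU.hGR₁ hGRU) (ArchSideTerm.muSharp₂₃ @μ))) (EtaChi.hη (@SInstance.χVR (@SInstance.GRU.hGR hGRU) (@SInstance.GRU.hGR₀ hGRU) (@SInstance.GRU.hGR₁ hGRU)) (@SInstance.χWR (@SInstance.GRU.hGR hGRU) (@SInstance.GRU.hGR₀ hGRU) (@SInstance.GRU.hGR₁ hGRU) (ArchSideTerm.muSharp₂₃ @μ))) (EtaChi.hηc (@SInstance.χVR (@SInstance.GRU.hGR hGRU) (@SInstance.GRU.hGR₀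 hGRU) (@SInstance.GRU.hGR₁ hGRU)) (@SInstance.χWR (@SInstance.GRU.hGR hGRU) (@SInstance.GRU.hGR₀ hGRU) (@SInstance.GRU.hGR₁ hGRU) (ArchSideTerm.muSharp₂₃ @μ))))) (thetaOf _ (thetaClassInputOf _ (fun V c => thetaSpaceInputOf hHD hI h₁ (cmAbelianVarietyRealised_of_eigenbasis hHD hI h₃) (SInstance.SROGT'C (@SInstance.GRU.hGR hGRU) (@SInstance.GRU.hGR₀ hGRU) (@SInstance.GRU.hGR₁ hGRU) (@SInstance.GRU.hGR₂ hGRU) (@SInstance.GRU.hGR₃ hGRU) (ArchSideTerm.muSharp₂₃ @μ) (ArchSideTerm.hΔ₁_GOG_muSharp₂₃ (@SInstance.GRU.hGR hGRU) (@SInstance.GRU.hGR₀ hGRU) (@SInstance.GRU.hGR₁ hGRU) (@SInstance.GRU.hGR₂ hGRU) (@SInstance.GRU.hGR₃ hGRU) @μ) (ArchSideTerm.hΔ₂_GOG_muSharp₂₃ (@SInstance.GRU.hGR hGRU) (@SInstance.GRU.hGR₀ hGRU) (@SInstance.GRU.hGR₁ hGRU) (@SInstance.GRU.hGR₂ hGRU)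 (@SInstance.GRU.hGR₃ hGRU) @μ (ArchSideTerm.hSV_holds (@SInstance.GRU.hGR hGRU))) (ArchSideTerm.hΔ₃_GOG_muSharp₂₃ (@SInstance.GRU.hGR hGRU) (@SInstance.GRU.hGR₀ hGRU) (@SInstance.GRU.hGR₁ hGRU) (@SInstance.GRU.hGR₂ hGRU) (@SInstance.GRU.hGR₃ hGRU) @μ (ArchSideTerm.hSV_holds (@SInstance.GRU.hGR hGRU)))) V c))) (d12Of (ArchSideTerm.muSharp₂₃ @μ)) (d34Of (ArchSideTerm.muSharp₂₃ @μ))).GoodCtx ι₁ c → Module.finrank ℚ c.K = 6 ∧ IsNormalClosure ℚ c.K L ∧ (Module.finrank ℚ L = 24 ∨ Module.finrank ℚ L = 48) →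
      (NumberField.InfinitePlace.mk ι₁).embedding = ι₁ →
      ∀ i : Fin 4, ∃ Γ₀ : Level V, ∀ Γ ≤ Γ₀,
        ∃ D : CommonReflexInput c.K (c.Ψ i) c.σ,
          (thetaModelOf hHD hI h₁ (cmAbelianVarietyRealised_of_eigenbasis hHD hI h₃) (orientBitι L ι₁) (embOf hHD hI h₁ (cmAbelianVarietyRealised_of_eigenbasis hHD hI h₃)) (coverOf hHD hI h₁ (cmAbelianVarietyRealised_of_eigenbasis hHD hI h₃) hA) (wmOfInput (HypCensus.Wcm (@SInstance.GRU.hGR hGRU) (EtaChi.η (@SInstance.χVR (@SInstance.GRU.hGR hGRU) (@SInstance.GRU.hGR₀ hGRU) (@SInstance.GRU.hGR₁ hGRU)) (@SInstance.χWR (@SInstance.GRU.hGR hGRU) (@SInstance.GRU.hGR₀ hGRU) (@SInstance.GRU.hGR₁ hGRU) (ArchSideTerm.muSharp₂₃ @μ))) (EtaChi.hη (@SInstance.χVR (@SInstance.GRU.hGR hGRU) (@SInstance.GRU.hGR₀ hGRU) (@SInstance.GRU.hGR₁ hGRU)) (@SInstance.χWR (@SInstance.GRU.hGR hGRU) (@SInstance.GRU.hGR₀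 hGRU) (@SInstance.GRU.hGR₁ hGRU) (ArchSideTerm.muSharp₂₃ @μ))) (EtaChi.hηc (@SInstance.χVR (@SInstance.GRU.hGR hGRU) (@SInstance.GRU.hGR₀ hGRU) (@SInstance.GRU.hGR₁ hGRU)) (@SInstance.χWR (@SInstance.GRU.hGR hGRU) (@SInstance.GRU.hGR₀ hGRU) (@SInstance.GRU.hGR₁ hGRU) (ArchSideTerm.muSharp₂₃ @μ))))) (thetaOf _ (thetaClassInputOf _ (fun V c => thetaSpaceInputOf hHD hI h₁ (cmAbelianVarietyRealised_of_eigenbasis hHD hI h₃) (SInstance.SROGT'C (@SInstance.GRU.hGR hGRU) (@SInstance.GRU.hGR₀ hGRU) (@SInstance.GRU.hGR₁ hGRU) (@SInstance.GRU.hGR₂ hGRU) (@SInstance.GRU.hGR₃ hGRU) (ArchSideTerm.muSharp₂₃ @μ) (ArchSideTerm.hΔ₁_GOG_muSharp₂₃ (@SInstance.GRU.hGR hGRU) (@SInstance.GRU.hGR₀ hGRU) (@SInstance.GRU.hGR₁ hGRU) (@SInstance.GRU.hGR₂ hGRU) (@SInstance.GRU.hGR₃ hGRU) @μ) (ArchSideTerm.hΔ₂_GOG_muSharp₂₃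 (@SInstance.GRU.hGR hGRU) (@SInstance.GRU.hGR₀ hGRU) (@SInstance.GRU.hGR₁ hGRU) (@SInstance.GRU.hGR₂ hGRU) (@SInstance.GRU.hGR₃ hGRU) @μ (ArchSideTerm.hSV_holds (@SInstance.GRU.hGR hGRU))) (ArchSideTerm.hΔ₃_GOG_muSharp₂₃ (@SInstance.GRU.hGR hGRU) (@SInstance.GRU.hGR₀ hGRU) (@SInstance.GRU.hGR₁ hGRU) (@SInstance.GRU.hGR₂ hGRU) (@SInstance.GRU.hGR₃ hGRU) @μ (ArchSideTerm.hSV_holds (@SInstance.GRU.hGR hGRU)))) V c))) (d12Of (ArchSideTerm.muSharp₂₃ @μ)) (d34Of (ArchSideTerm.muSharp₂₃ @μ))).Theta V c i Γ ⊆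
            Submodule.span ℂ (D.surfaceClasses hHD hI h₁ (cmAbelianVarietyRealised_of_eigenbasis hHD hI h₃) V Γ)) :
     (picardCMUniverse hHD hI h₁ (cmAbelianVarietyRealised_of_eigenbasis hHD hI h₃)).PerL
:=
  perL_picardCM_r21AEOGISTR2DJWHHTCG hHD hI h₁ h₃ hA (@SInstance.GRU.hGR hGRU) (@SInstance.GRU.hGR₀ hGRU) (@SInstance.GRU.hGR₁ hGRU)
    (@SInstance.GRU.hGR₂ hGRU) (@SInstance.GRU.hGR₃ hGRU) μ hR hΘ

end Model

end HodgeCM
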